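import Summits.ResolutionOfSingularities.ResolutionOfSingularities.Theorems.StallVertexEcho
import HarnessLib

/-!
# StallVertexLockAlgebra — decomp-res node «StallVertex» (lens-5 g23 rev 9), add-on tree file 1/4: the two monomials
of a two-layer cone (§1l, generic)

Content VERBATIM from the decomp-res lens-5 tree-ready slices
`HOME/decomp-res-lens-5/g23/parts/StallVertexLock.lean` (fe40ed9c) /
`StallVertexLockClasses.lean` (05ee4541) of the node file `g23/StallVertex.lean` rev 9 (pin fbb7fe50 = rev 8
9799ca34 + four pure insertions
§1l / §3j / §4k; critic machine diff, CRITIC-LEDGER row 162 DECIDED +1: THE TURN LOCK; HOME =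
run/shared/lean/pub/decomp-res; landing order
INBOX :609 / :618).  Landed by decomp-res writer g9 as `StallVertexLockAlgebra` (§1l), `StallVertexLock` (§3j),
`StallVertexLockClasses`
(§4k cells and exact re-locations, cone-free) and the wiring file `MaxContactCutStallVertexLock` (§4k chain to the
target BY NAME); the 420-line
slice is split only to respect the 400-line file cap, declarations and proofs byte-identical.

After an interference the untranslated walk turns AT MOST ONCE (`turn_lock_chain`, `turn_lock_law`,
`two_moves_after_interference`), hypothesis-free along root walks, every `q = p^e`, every field of characteristic `p`.
Generic §1l: the two monomials of a resonant two-layer cone (`coeff_two_layer_low/high`), three-letter degree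
bookkeeping (`Fin3.lt_third`).  Walk level §3j: `exponent_eq_of_originLawAt`, the invariant `TwoMarks` (born by
`twoMarks_of_interference_turn`, carried by `twoMarks_succ`, biting in `chart_eq_of_twoMarks`), the kernel predicates
`DoubleTurnAt` / `SecondTurnAt` and their exclusion on stalled stretches.  Host: route `MaxContactCut`, aside
`MaxContactCut.DefectWalksDeep` (stmt-…-31770); node file
`run/shared/lean/pub/decomp-res/decomp-res-lens-5/g23/StallVertex.lean`.

[WRITER NOTE (decomp-res writer g9): the lens lemma `Fin3.degree_eq_three` restated the landed
 `Literature.Combinatorics.Extremal.finsuppDegree_fin_three` (gate `dedup.landed`, p799831) — copy dropped and its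
two-lemma proof
 (`Finsupp.degree_eq_sum`, `Fin.sum_univ_three`) inlined at the one use in `Fin3.lt_third` (the Literature module is
not imported: its closure
 `RuledSurfaceLines` is outside this node); nothing else changed.]
-/

noncomputable section

open MvPolynomial Finset
open Literature.AlgebraicGeometry.Resolution
open Literature.AlgebraicGeometry.Resolution.Hauser2010
open Literature.AlgebraicGeometry.Resolution.HauserPerlega2024
open Literature.Barriers.ResolutionOfSingularities
open Literature.AlgebraicGeometry.Resolution.PointBlowup
open Summit.ResolutionOfSingularities.ResolutionOfSingularities.Theses
open Summit.ResolutionOfSingularities.ResolutionOfSingularities.Theorems.TightDefectClasses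
open Summit.ResolutionOfSingularities.ResolutionOfSingularities.Theorems.ProximityCut
open Summit.ResolutionOfSingularities.ResolutionOfSingularities.Theorems.ExitLaw
open Summit.ResolutionOfSingularities.ResolutionOfSingularities.Theorems.DifferentialShade

namespace Summit.ResolutionOfSingularities.ResolutionOfSingularities.Theorems.StallVertex

/-! ### §1l (rev 9, generation 23) THE TWO MONOMIALS OF A TWO-LAYER CONE (generic).  In the resonant cone
`u_j^e · (A + u_j · B)` (`A` `u_j`-free) a monomial `u^s` of `A` survives as `u^{s + e·1_j}` and a monomial `u^s` of `B` as
`u^{s + (e+1)·1_j}`: the two layers have DISJOINT supports (different `u_j`-exponents), nothing cancels. -/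

section AlgebraLock

variable {σ : Type*} {K : Type*} [Field K] [DecidableEq σ]

omit [DecidableEq σ] in
/-- Splitting of the two-layer product into two monomial multiples. [folklore] -/
theorem two_layer_eq_monomial_mul (j : σ) (e : ℕ) (A B : MvPolynomial σ K) :
    X j ^ e * (A + X j * B) =
      monomial (Finsupp.single j e) (1 : K) * A + monomial (Finsupp.single j (e + 1)) (1 : K) * B := by
  rw [mul_add, ← mul_assoc, ← pow_succ, X_pow_eq_monomial, X_pow_eq_monomial]

omit [DecidableEq σ] in
/-- **The low layer survives**: for `s` with `s_j = 0`, the coefficient of `u^{s + e·1_j}` in `u_j^e (A + u_j B)` is the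
coefficient of `u^s` in `A`. [folklore] -/
theorem coeff_two_layer_low (j : σ) (e : ℕ) (A B : MvPolynomial σ K) {s : σ →₀ ℕ} (hsj : s j = 0) :
    coeff (s + Finsupp.single j e) (X j ^ e * (A + X j * B)) = coeff s A := by
  classical
  rw [two_layer_eq_monomial_mul, coeff_add, coeff_monomial_mul', coeff_monomial_mul', if_pos le_add_self, one_mul,
    add_tsub_cancel_right, if_neg, add_zero]
  intro h
  have h' := Finsupp.le_def.mp h j
  rw [Finsupp.add_apply, Finsupp.single_eq_same, Finsupp.single_eq_same, hsj] at h'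
  omega

omit [DecidableEq σ] in
/-- **The high layer survives**: for `A` `u_j`-free, the coefficient of `u^{s + (e+1)·1_j}` in `u_j^e (A + u_j B)` is the
coefficient of `u^s` in `B`. [folklore] -/
theorem coeff_two_layer_high (j : σ) (e : ℕ) {A : MvPolynomial σ K} (B : MvPolynomial σ K)
    (hA : ∀ s' ∈ A.support, s' j = 0) (s : σ →₀ ℕ) :
    coeff (s + Finsupp.single j (e + 1)) (X j ^ e * (A + X j * B)) = coeff s B := by
  classical
  have hle : Finsupp.single j e ≤ s + Finsupp.single j (e + 1) := Finsupp.le_def.mpr fun i => by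
    rw [Finsupp.add_apply, Finsupp.single_apply, Finsupp.single_apply]
    split_ifs <;> omega
  rw [two_layer_eq_monomial_mul, coeff_add, coeff_monomial_mul', coeff_monomial_mul', if_pos hle, one_mul,
    if_pos le_add_self, one_mul, add_tsub_cancel_right]
  have h0 : coeff (s + Finsupp.single j (e + 1) - Finsupp.single j e) A = 0 := by
    by_contra hne
    have h := hA _ (MvPolynomial.mem_support_iff.mpr hne)
    rw [Finsupp.tsub_apply, Finsupp.add_apply, Finsupp.single_eq_same, Finsupp.single_eq_same] at h
    omega
  rw [h0, zero_add]

/-- **Exponent bookkeeping over three letters**: two exponents of the same degree that agree at `j'` and increase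
strictly at `j` decrease strictly at the third letter `c`. [folklore] -/
theorem Fin3.lt_third {j j' c : Fin 3} (hjj' : j' ≠ j) (hcj : c ≠ j) (hcj' : c ≠ j') {m₁ m₂ : Fin 3 →₀ ℕ}
    (hdeg : m₁.degree = m₂.degree) (hj' : m₁ j' = m₂ j') (hj : m₁ j < m₂ j) : m₂ c < m₁ c := by
  rw [Finsupp.degree_eq_sum, Finsupp.degree_eq_sum, Fin.sum_univ_three, Fin.sum_univ_three] at hdeg
  fin_cases j <;> fin_cases j' <;> fin_cases c <;> simp_all <;> omega

end AlgebraLock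

end Summit.ResolutionOfSingularities.ResolutionOfSingularities.Theorems.StallVertex
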